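import Summits.Ventures.HodgeRepro2.T5HeckeTranspose
import Summits.Ventures.HodgeRepro2.T5HeckeConvolutionAlgebra

/-!
# Transport of the Hecke algebra `H(G, K)` along an automorphism of `G` preserving `K`

Kernel annex of the Tier-5 record (blind lane).  An automorphism `σ : G ≃* G` with `σ(K) = K`
(carried as `hσ : ∀ x, σ x ∈ K ↔ x ∈ K`) induces

* a bijection `quotEquiv σ hσ : G ⧸ K ≃ G ⧸ K`, `xK ↦ σ(x)K`, twisted-equivariant
  (`quotEquiv_smul : e (g • x) = σ g • e x`) and carrying `K`-orbits to `K`-orbits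
  (`quotEquiv_image_orbit`);
* a `k`-linear automorphism `transport σ hσ` of `k[G/K]`, `(transport t)(σ(x)K) = t(xK)`, which
  preserves the `K`-invariants, the convolution of `T5HeckeConvolution`
  (`transport_conv : (t ∗ s)^σ = t^σ ∗ s^σ`), the unit `δ_K`, and sends the double-coset vector
  `1_{KgK}` to `1_{Kσ(g)K}` (`transport_orbitVector_orbit`);
* an algebra automorphism `transportOp σ hσ` of `H(G, K) = End_G(k[G/K])`
  (`transportOp_mul`, `transportOp_one`, `transportOp_add`, `transportOp_smul`), with
  `T_g ↦ T_{σ(g)}` (`transportOp_doubleCosetOp`) and inverse `transportOp σ.symm`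
  (`transportOp_symm_transportOp`).

Used by `T5HeckeGelfandTrickGeneral` (the anti-automorphism form of Gelfand's trick: an
anti-automorphism `τ = σ ∘ inv` of `G` is the composite of this transport with the anti-involution
`t ↦ t^∨` of `T5HeckeTranspose`).  What stays prose: the printed theorems; which automorphism of a
specific group is meant.
-/

namespace Summit.Ventures.HodgeRepro2.T5HeckeAutomorphismTransport

open T5HeckePermutationModule T5HeckeConvolution T5HeckeTranspose LevelPositivity

variable {G : Type*} [Group G] {k : Type*} [Field k] {K : Subgroup G}

section Quot

variable (σ : G ≃* G)

/-- The bijection `xK ↦ σ(x)K` of `G ⧸ K` induced by an automorphism `σ` with `σ(K) = K`. -/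
def quotEquiv (hσ : ∀ x : G, σ x ∈ K ↔ x ∈ K) : G ⧸ K ≃ G ⧸ K :=
  Quotient.congr σ.toEquiv (fun a b => by
    rw [QuotientGroup.leftRel_apply, QuotientGroup.leftRel_apply]
    simp only [MulEquiv.toEquiv_eq_coe, MulEquiv.coe_toEquiv]
    rw [← map_inv, ← map_mul, hσ])

/-- `e (xK) = σ(x)K`. -/
@[simp]
theorem quotEquiv_mk (hσ : ∀ x : G, σ x ∈ K ↔ x ∈ K) (x : G) : quotEquiv σ hσ (x : G ⧸ K) = ((σ x : G) : G ⧸ K) := rfl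

/-- `e⁻¹ (xK) = σ⁻¹(x)K`. -/
@[simp]
theorem quotEquiv_symm_mk (hσ : ∀ x : G, σ x ∈ K ↔ x ∈ K) (x : G) :
    (quotEquiv σ hσ).symm (x : G ⧸ K) = ((σ.symm x : G) : G ⧸ K) := rfl

/-- Twisted equivariance: `e (g • x) = σ g • e x`. -/
theorem quotEquiv_smul (hσ : ∀ x : G, σ x ∈ K ↔ x ∈ K) (g : G) (x : G ⧸ K) :
    quotEquiv σ hσ (g • x) = σ g • quotEquiv σ hσ x := by
  induction x using QuotientGroup.induction_on with
  | H x =>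
    change quotEquiv σ hσ ((g * x : G) : G ⧸ K) = σ g • ((σ x : G) : G ⧸ K)
    rw [quotEquiv_mk, map_mul]
    rfl

/-- `σ` restricts to a bijection of `K`; hence `e` carries the `K`-orbit of `x` onto the
`K`-orbit of `e x`. -/
theorem quotEquiv_image_orbit (hσ : ∀ x : G, σ x ∈ K ↔ x ∈ K) (x : G ⧸ K) :
    quotEquiv σ hσ '' MulAction.orbit K x = MulAction.orbit K (quotEquiv σ hσ x) := by
  ext y
  constructor
  · rintro ⟨z, ⟨⟨κ, hκ⟩, rfl⟩, rfl⟩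
    refine ⟨⟨σ κ, (hσ κ).2 hκ⟩, ?_⟩
    change σ κ • quotEquiv σ hσ x = quotEquiv σ hσ (κ • x)
    exact (quotEquiv_smul σ hσ κ x).symm
  · rintro ⟨⟨κ, hκ⟩, rfl⟩
    refine ⟨(σ.symm κ : G) • x, ⟨⟨σ.symm κ, (hσ _).1 (by simpa using hκ)⟩, rfl⟩, ?_⟩
    change quotEquiv σ hσ (σ.symm κ • x) = κ • quotEquiv σ hσ x
    rw [quotEquiv_smul, MulEquiv.apply_symm_apply]

/-- Finiteness of `K`-orbits is preserved by `e`. -/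
theorem finite_orbit_quotEquiv (hσ : ∀ x : G, σ x ∈ K ↔ x ∈ K) (x : G ⧸ K) [Finite (MulAction.orbit K x)] :
    Finite (MulAction.orbit K (quotEquiv σ hσ x)) := by
  rw [← quotEquiv_image_orbit]
  exact Set.Finite.image _ (Set.toFinite _)

end Quot

section Transport

variable (σ : G ≃* G)

/-- Transport of `k[G/K]` along `σ`: `(transport t)(σ(x)K) = t(xK)`. -/
noncomputable def transport (hσ : ∀ x : G, σ x ∈ K ↔ x ∈ K) (t : MonoidAlgebra k (G ⧸ K)) : MonoidAlgebra k (G ⧸ K) :=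
  MonoidAlgebra.ofCoeff (Finsupp.equivMapDomain (quotEquiv σ hσ) t.coeff)

/-- Coefficients of the transport: `(transport t)(y) = t(e⁻¹ y)`. -/
theorem coeff_transport (hσ : ∀ x : G, σ x ∈ K ↔ x ∈ K) (t : MonoidAlgebra k (G ⧸ K)) (y : G ⧸ K) :
    (transport σ hσ t).coeff y = t.coeff ((quotEquiv σ hσ).symm y) := by
  simp only [transport, MonoidAlgebra.coeff_ofCoeff, Finsupp.equivMapDomain_apply]

/-- `(transport t)(e x) = t(x)`. -/
@[simp]
theorem coeff_transport_apply (hσ : ∀ x : G, σ x ∈ K ↔ x ∈ K) (t : MonoidAlgebra k (G ⧸ K)) (x : G ⧸ K) :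
    (transport σ hσ t).coeff (quotEquiv σ hσ x) = t.coeff x := by
  rw [coeff_transport, Equiv.symm_apply_apply]

/-- `(transport t)(σ(x)K) = t(xK)`. -/
theorem coeff_transport_mk (hσ : ∀ x : G, σ x ∈ K ↔ x ∈ K) (t : MonoidAlgebra k (G ⧸ K)) (x : G) :
    (transport σ hσ t).coeff ((σ x : G) : G ⧸ K) = t.coeff (x : G ⧸ K) :=
  coeff_transport_apply σ hσ t (x : G ⧸ K)

/-- The transport is additive. -/
theorem transport_add (hσ : ∀ x : G, σ x ∈ K ↔ x ∈ K) (t s : MonoidAlgebra k (G ⧸ K)) :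
    transport σ hσ (t + s) = transport σ hσ t + transport σ hσ s := by
  apply MonoidAlgebra.ext
  apply Finsupp.ext
  intro y
  simp only [MonoidAlgebra.coeff_add, Finsupp.coe_add, Pi.add_apply, coeff_transport]

/-- The transport is `k`-homogeneous. -/
theorem transport_smul (hσ : ∀ x : G, σ x ∈ K ↔ x ∈ K) (c : k) (t : MonoidAlgebra k (G ⧸ K)) :
    transport σ hσ (c • t) = c • transport σ hσ t := by
  apply MonoidAlgebra.ext
  apply Finsupp.ext
  intro y
  simp only [MonoidAlgebra.coeff_smul, Finsupp.coe_smul, Pi.smul_apply, coeff_transport]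

/-- The transport of `0` is `0`. -/
theorem transport_zero (hσ : ∀ x : G, σ x ∈ K ↔ x ∈ K) : transport σ hσ (0 : MonoidAlgebra k (G ⧸ K)) = 0 := by
  apply MonoidAlgebra.ext
  apply Finsupp.ext
  intro y
  simp only [coeff_transport, MonoidAlgebra.coeff_zero, Finsupp.coe_zero, Pi.zero_apply]

/-- The transport as a `k`-linear map. -/
noncomputable def transportLinear (hσ : ∀ x : G, σ x ∈ K ↔ x ∈ K) : MonoidAlgebra k (G ⧸ K) →ₗ[k] MonoidAlgebra k (G ⧸ K) where
  toFun := transport σ hσ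
  map_add' := transport_add σ hσ
  map_smul' := transport_smul σ hσ

/-- `transportLinear` acts as `transport`. -/
@[simp]
theorem transportLinear_apply (hσ : ∀ x : G, σ x ∈ K ↔ x ∈ K) (t : MonoidAlgebra k (G ⧸ K)) :
    transportLinear σ hσ t = transport σ hσ t := rfl

/-- The transport of `δ_x` is `δ_{e x}`. -/
theorem transport_single (hσ : ∀ x : G, σ x ∈ K ↔ x ∈ K) (x : G ⧸ K) (c : k) :
    transport σ hσ (MonoidAlgebra.single x c) = MonoidAlgebra.single (quotEquiv σ hσ x) c := by
  apply MonoidAlgebra.ext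
  apply Finsupp.ext
  intro y
  obtain ⟨y', rfl⟩ := (quotEquiv σ hσ).surjective y
  rw [coeff_transport, Equiv.symm_apply_apply, MonoidAlgebra.coeff_single,
    MonoidAlgebra.coeff_single, Finsupp.single_apply_left (quotEquiv σ hσ).injective]

/-- `δ_K` is fixed. -/
theorem transport_single_one (hσ : ∀ x : G, σ x ∈ K ↔ x ∈ K) :
    transport σ hσ (MonoidAlgebra.single ((1 : G) : G ⧸ K) (1 : k)) =
      MonoidAlgebra.single ((1 : G) : G ⧸ K) 1 := by
  rw [transport_single, quotEquiv_mk, map_one]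

/-- Transport along `σ.symm` inverts the transport along `σ`. -/
theorem transport_symm_transport (hσ : ∀ x : G, σ x ∈ K ↔ x ∈ K) (hσ' : ∀ x : G, σ.symm x ∈ K ↔ x ∈ K)
    (t : MonoidAlgebra k (G ⧸ K)) :
    transport σ.symm hσ' (transport σ hσ t) = t := by
  apply MonoidAlgebra.ext
  apply Finsupp.ext
  intro y
  induction y using QuotientGroup.induction_on with
  | H y =>
    rw [coeff_transport, quotEquiv_symm_mk, MulEquiv.symm_symm, coeff_transport, quotEquiv_symm_mk,
      MulEquiv.symm_apply_apply]

/-- `σ(K) = K` is a symmetric condition. -/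
theorem symm_mem_iff (hσ : ∀ x : G, σ x ∈ K ↔ x ∈ K) (x : G) : σ.symm x ∈ K ↔ x ∈ K := by
  conv_rhs => rw [← MulEquiv.apply_symm_apply σ x]
  exact (hσ _).symm

/-- The transport preserves the `K`-invariants of `k[G/K]`. -/
theorem transport_mem_invariants (hσ : ∀ x : G, σ x ∈ K ↔ x ∈ K) {t : MonoidAlgebra k (G ⧸ K)}
    (ht : t ∈ invariants (Representation.ofMulAction k G (G ⧸ K)) K) :
    transport σ hσ t ∈ invariants (Representation.ofMulAction k G (G ⧸ K)) K := by
  rw [T5HeckeDoubleCosetBasis.mem_invariants_ofMulAction_iff] at ht ⊢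
  intro κ hκ x
  obtain ⟨y, rfl⟩ := (quotEquiv σ hσ).surjective x
  have hκ' : σ.symm κ ∈ K := (symm_mem_iff σ hσ κ).2 hκ
  have e1 : κ • quotEquiv σ hσ y = quotEquiv σ hσ (σ.symm κ • y) := by
    rw [quotEquiv_smul, MulEquiv.apply_symm_apply]
  rw [e1, coeff_transport_apply, coeff_transport_apply]
  exact ht _ hκ' y

/-- The key reindexing: for `K`-invariant `t`,
`(transport t)((out (e x))⁻¹ • e z) = t((out x)⁻¹ • z)`. -/
theorem coeff_transport_inv_out_smul (hσ : ∀ x : G, σ x ∈ K ↔ x ∈ K) {t : MonoidAlgebra k (G ⧸ K)}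
    (ht : t ∈ invariants (Representation.ofMulAction k G (G ⧸ K)) K) (x z : G ⧸ K) :
    (transport σ hσ t).coeff ((Quotient.out (quotEquiv σ hσ x))⁻¹ • quotEquiv σ hσ z) =
      t.coeff ((Quotient.out x)⁻¹ • z) := by
  have hT := transport_mem_invariants σ hσ ht
  have hx : quotEquiv σ hσ x = ((σ (Quotient.out x) : G) : G ⧸ K) := by
    conv_lhs => rw [← Quotient.out_eq' x]
    rfl
  rw [hx, coeff_inv_out_smul hT (σ (Quotient.out x)) _]
  have e1 : (σ (Quotient.out x))⁻¹ • quotEquiv σ hσ z =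
      quotEquiv σ hσ ((Quotient.out x)⁻¹ • z) := by
    rw [quotEquiv_smul, map_inv]
  rw [e1, coeff_transport_apply]

/-- The transport is multiplicative for the convolution: `(t ∗ s)^σ = t^σ ∗ s^σ`
(`t` `K`-invariant; the coefficient formula `(t ∗ s)(zK) = Σ_{xK} s(xK) t((out xK)⁻¹ zK)` is
reindexed along `e`). -/
theorem transport_conv (hσ : ∀ x : G, σ x ∈ K ↔ x ∈ K) {t : MonoidAlgebra k (G ⧸ K)}
    (ht : t ∈ invariants (Representation.ofMulAction k G (G ⧸ K)) K)
    (s : MonoidAlgebra k (G ⧸ K)) :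
    transport σ hσ (conv t s) = conv (transport σ hσ t) (transport σ hσ s) := by
  apply MonoidAlgebra.ext
  apply Finsupp.ext
  intro w
  obtain ⟨z, rfl⟩ := (quotEquiv σ hσ).surjective w
  rw [coeff_transport_apply, coeff_conv, coeff_conv]
  have hs : (transport σ hσ s).coeff = Finsupp.equivMapDomain (quotEquiv σ hσ) s.coeff := by
    simp only [transport, MonoidAlgebra.coeff_ofCoeff]
  rw [hs, Finsupp.sum_equivMapDomain]
  refine Finsupp.sum_congr (fun x _ => ?_)
  rw [coeff_transport_inv_out_smul σ hσ ht x z]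

/-- The transport of the indicator vector of a finite set `O ⊆ G ⧸ K` is the indicator vector of
`e '' O`. -/
theorem transport_orbitVector (hσ : ∀ x : G, σ x ∈ K ↔ x ∈ K) {O : Set (G ⧸ K)} (hO : O.Finite) :
    transport σ hσ (T5HeckeDoubleCoset.orbitVector k K O) =
      T5HeckeDoubleCoset.orbitVector k K (quotEquiv σ hσ '' O) := by
  apply MonoidAlgebra.ext
  apply Finsupp.ext
  intro w
  obtain ⟨y, rfl⟩ := (quotEquiv σ hσ).surjective w
  rw [coeff_transport_apply, T5HeckeDoubleCosetBasis.coeff_orbitVector k K hO,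
    T5HeckeDoubleCosetBasis.coeff_orbitVector k K (hO.image _)]
  by_cases hy : y ∈ O
  · rw [Set.indicator_of_mem hy, Set.indicator_of_mem (Set.mem_image_of_mem _ hy)]
    rfl
  · rw [Set.indicator_of_notMem hy, Set.indicator_of_notMem]
    rw [(quotEquiv σ hσ).injective.mem_set_image]
    exact hy

/-- `1_{KgK} ↦ 1_{Kσ(g)K}`. -/
theorem transport_orbitVector_orbit (hσ : ∀ x : G, σ x ∈ K ↔ x ∈ K) (g : G) [Finite (MulAction.orbit K ((g : G) : G ⧸ K))] :
    transport σ hσ (T5HeckeDoubleCoset.orbitVector k K (MulAction.orbit K ((g : G) : G ⧸ K))) =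
      T5HeckeDoubleCoset.orbitVector k K (MulAction.orbit K ((σ g : G) : G ⧸ K)) := by
  rw [transport_orbitVector σ hσ (Set.toFinite _), quotEquiv_image_orbit, quotEquiv_mk]

end Transport

section HeckeAlgebra

variable (σ : G ≃* G)

/-- The transport on `H(G, K) = End_G(k[G/K])`: `T ↦ (T δ_K)^σ` through
`heckeAlgebraEquivInvariants`. -/
noncomputable def transportOp (hσ : ∀ x : G, σ x ∈ K ↔ x ∈ K) (T : heckeAlgebra k K) : heckeAlgebra k K :=
  heckeAlgebraEquivInvariants.symm
    ⟨transport σ hσ ((T : Module.End k (MonoidAlgebra k (G ⧸ K)))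
        (MonoidAlgebra.single ((1 : G) : G ⧸ K) 1)),
      transport_mem_invariants σ hσ (apply_single_one_mem_invariants T)⟩

/-- `(transportOp T) δ_K = (T δ_K)^σ`. -/
theorem transportOp_apply_single_one (hσ : ∀ x : G, σ x ∈ K ↔ x ∈ K) (T : heckeAlgebra k K) :
    (transportOp σ hσ T : Module.End k (MonoidAlgebra k (G ⧸ K)))
        (MonoidAlgebra.single ((1 : G) : G ⧸ K) 1) =
      transport σ hσ ((T : Module.End k (MonoidAlgebra k (G ⧸ K)))
        (MonoidAlgebra.single ((1 : G) : G ⧸ K) 1)) :=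
  T5HeckeConvolutionAlgebra.coe_heckeAlgebraEquivInvariants_symm_apply_single_one _

/-- `transportOp` is multiplicative: an automorphism of the algebra `H(G, K)`. -/
theorem transportOp_mul (hσ : ∀ x : G, σ x ∈ K ↔ x ∈ K) (T S : heckeAlgebra k K) :
    transportOp σ hσ (T * S) = transportOp σ hσ T * transportOp σ hσ S := by
  apply ext_of_apply_single_one
  rw [transportOp_apply_single_one, mul_apply_single_one_eq_conv, mul_apply_single_one_eq_conv,
    transportOp_apply_single_one, transportOp_apply_single_one,
    transport_conv σ hσ (apply_single_one_mem_invariants T)]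

/-- `transportOp` fixes the unit of `H(G, K)`. -/
theorem transportOp_one (hσ : ∀ x : G, σ x ∈ K ↔ x ∈ K) : transportOp σ hσ (1 : heckeAlgebra k K) = 1 := by
  apply ext_of_apply_single_one
  rw [transportOp_apply_single_one, one_apply_single_one, transport_single_one]

/-- `transportOp` is additive. -/
theorem transportOp_add (hσ : ∀ x : G, σ x ∈ K ↔ x ∈ K) (T S : heckeAlgebra k K) :
    transportOp σ hσ (T + S) = transportOp σ hσ T + transportOp σ hσ S := by
  apply ext_of_apply_single_one
  rw [transportOp_apply_single_one, Subalgebra.coe_add, LinearMap.add_apply, transport_add,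
    Subalgebra.coe_add, LinearMap.add_apply, transportOp_apply_single_one,
    transportOp_apply_single_one]

/-- `transportOp` is `k`-homogeneous. -/
theorem transportOp_smul (hσ : ∀ x : G, σ x ∈ K ↔ x ∈ K) (c : k) (T : heckeAlgebra k K) :
    transportOp σ hσ (c • T) = c • transportOp σ hσ T := by
  apply ext_of_apply_single_one
  rw [transportOp_apply_single_one, Subalgebra.coe_smul, LinearMap.smul_apply, transport_smul,
    Subalgebra.coe_smul, LinearMap.smul_apply, transportOp_apply_single_one]

/-- `T_g ↦ T_{σ(g)}`. -/
theorem transportOp_doubleCosetOp (hσ : ∀ x : G, σ x ∈ K ↔ x ∈ K) (g : G) [Finite (MulAction.orbit K ((g : G) : G ⧸ K))]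
    [Finite (MulAction.orbit K ((σ g : G) : G ⧸ K))] :
    transportOp σ hσ (T5HeckeDoubleCoset.doubleCosetOp k K g) =
      T5HeckeDoubleCoset.doubleCosetOp k K (σ g) := by
  apply ext_of_apply_single_one
  rw [transportOp_apply_single_one, T5HeckeDoubleCoset.doubleCosetOp_apply_single_one,
    T5HeckeDoubleCoset.doubleCosetOp_apply_single_one, transport_orbitVector_orbit]

/-- The transport along `σ.symm` inverts the transport along `σ`: `transportOp σ` is an
automorphism of `H(G, K)`. -/
theorem transportOp_symm_transportOp (hσ : ∀ x : G, σ x ∈ K ↔ x ∈ K) (hσ' : ∀ x : G, σ.symm x ∈ K ↔ x ∈ K)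
    (T : heckeAlgebra k K) :
    transportOp σ.symm hσ' (transportOp σ hσ T) = T := by
  apply ext_of_apply_single_one
  rw [transportOp_apply_single_one, transportOp_apply_single_one, transport_symm_transport]

/-- The transport packaged as a `k`-algebra automorphism of `H(G, K)`. -/
noncomputable def transportAlgEquiv (hσ : ∀ x : G, σ x ∈ K ↔ x ∈ K) : heckeAlgebra k K ≃ₐ[k] heckeAlgebra k K where
  toFun := transportOp σ hσ
  invFun := transportOp σ.symm (symm_mem_iff σ hσ)
  left_inv T := transportOp_symm_transportOp σ hσ _ T
  right_inv T := by
    have h := transportOp_symm_transportOp σ.symm (symm_mem_iff σ hσ)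
      (by simpa only [MulEquiv.symm_symm] using hσ) T
    simpa only [MulEquiv.symm_symm] using h
  map_mul' := transportOp_mul σ hσ
  map_add' := transportOp_add σ hσ
  commutes' c := by
    rw [Algebra.algebraMap_eq_smul_one, transportOp_smul, transportOp_one]

/-- `transportAlgEquiv` acts as `transportOp`. -/
@[simp]
theorem transportAlgEquiv_apply (hσ : ∀ x : G, σ x ∈ K ↔ x ∈ K) (T : heckeAlgebra k K) :
    transportAlgEquiv σ hσ T = transportOp σ hσ T := rfl

end HeckeAlgebra

end Summit.Ventures.HodgeRepro2.T5HeckeAutomorphismTransport
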